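import Mathlib
import HarnessLib
import Summits.AtomisticToContinuum.FouriersLaw.Theses.JunctionLocality
import Summits.AtomisticToContinuum.FouriersLaw.Theorems.JunctionLocalitySuperadditiveResistanceStubKappaFrame
import Summits.AtomisticToContinuum.FouriersLaw.Theorems.JunctionLocalitySuperadditiveResistanceStubPlainForwardField
import Summits.AtomisticToContinuum.FouriersLaw.Theorems.JunctionLocalitySuperadditiveResistanceTerminationIdentity
import Summits.AtomisticToContinuum.FouriersLaw.Theorems.JunctionLocalitySuperadditiveResistanceStubBypassBoundAux3

/-!
# Bypass-bound helpers V: the κ-frame FAR-TRANSMISSION IDENTITY and the reduction of S2' to ONE `N`-uniform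
# inequality (helpers `--supports` stmt-AtomisticToContinuum-11748 for stub `stub_bypassBound` (S2') of line
# `floating-probe-bypass-laplacian`, skeleton v7, crux `JunctionLocality.SuperadditiveResistance`)

Notation as in part IV (`…StubBypassBoundAux4`): `g` a family of `κ`-resolvent fields of the four terminals of the
`(N, M)`-device, `K` its resolvent Kubo matrix, `x = −K₀₃`, `a = K₀₀`, `b = K₃₃`, `L = N + M`; `g_N` a plain forward
field of the bare `N`-chain (`plainForwardFields`, one exists by the landed `stub_plainForwardField`), `π_N` the
left-block map, `R` the momentum reversal, `V'(r) = r + βr³` the junction force on `r_J = q_N − q_{N−1}`. This file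
proves, at FIXED `N, M, κ` (nothing taken as a named fact):

* `bypass_eq_defectPairing` — for every left-block observable `F` with `F∘π_N ∈ L²(μ_T)`,
  `x = (γ²/T²)·⟨g_0 − F∘π_N, p_{L−1}² − T⟩_{μ_T}` (the lifted observable is invisible to the far bath, landed
  `integral_sub_comp_restrictLeft_mul_kin_sub`);
* `farDefect_pair` — the κ-frame defect equation in pair form (lambda form of helper V of S1',
  `…StubTerminationLocalityAux5.deviceResolvent_defect_pair`): `u = g_0 − g_N∘π_N` solves
  `X_H u + γ S_B u = −(V'(r_J)(∂_{p_{N−1}} g_N)∘π_N − κ g_0)`;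
* `farDefect_pairing_resolvent`, `bypass_eq_farPairing`, **`helper_bypassResolventIdentity`** (registered) — the
  κ-frame FAR-TRANSMISSION IDENTITY
  `x = (γ²/T²)·(⟨g_3∘R, V'(r_J)(∂_{p_{N−1}} g_N)∘π_N⟩_{μ_T} − κ·⟨g_3∘R, g_N∘π_N⟩_{μ_T})`:
  the landed cross Green identity `Kubo.cross` for the defect's resolvent pair against the BACKWARD resolvent pair
  `g_3∘R` of the far bath (the κ-frame analogue of the first line's `helper_farTransmissionIdentity`);
* **`helper_bypassBoundOfFarPairingBound`** (registered), `farPairingBound_of_bypassBound` — the registered stub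
  FOLLOWS, constant for constant and threshold for threshold, from the `N`-uniform far-pairing bound
  `(γ²/T²)(⟨g_3∘R, V'(r_J)(∂_{p_{N−1}} g_N)∘π_N⟩ − κ⟨g_3∘R, g_N∘π_N⟩) ≤ C₃ K₀₀ K₃₃` (eventually in `κ`, all resolvent
  families, all `g_N`; the named bet `FarTransmissionRemainderBoundκ`), and conversely;
* `bypassFarPairingConstants`, `bypassBoundConstants` (sets of admissible constants — objects, not propositions),
  `bypassFarPairingConstants_eq` (**the two sets COINCIDE**) and `stub_bypassBound_of_farPairingBound` (the
  registered stub from `(bypassFarPairingConstants …).Nonempty`): along the line's resolvent families S2' IS the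
  far-pairing bound — what remains is exactly this one `N`-uniform inequality ("double escape": pass the
  γ-thermostatted site `N−1` AND traverse the `M`-block), for which no engine is in print.
-/

noncomputable section

open MeasureTheory Filter Topology
open scoped ContDiff
open Literature.MathematicalPhysics.KineticTheory.HeatConduction
open Summit.AtomisticToContinuum.FouriersLaw.Theorems.SuperadditiveResistance.DeviceLiouville
  (kin deviceGenerator deviceWeight deviceGenerator_eq kin_eq_sq liouvilleOp bathOp)
open Summit.AtomisticToContinuum.FouriersLaw.Theorems.SuperadditiveResistance.Kubo
  (rev rev_apply contDiff_rev memLp_rev rev_pair cross memLp_kinetic integrable_mul_mul_gibbsDensity)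
open Summit.AtomisticToContinuum.FouriersLaw.Theorems.SuperadditiveResistance.TerminationLocality
  (restrictLeft memLp_comp_restrictLeft)
open Summit.AtomisticToContinuum.FouriersLaw.Cruxes.SuperadditiveResistance.ThermaliseThenCutProbeInsertion
  (deviceWeight_nonneg memLp_partialP_plainField memLp_junctionForce_mul_comp_restrictLeft)

namespace Summit.AtomisticToContinuum.FouriersLaw.Cruxes.SuperadditiveResistance.FloatingProbeBypassLaplacian

/-! ## §1 The κ-defect and the far-transmission identity -/

section Defect

variable {ω₂ lam β γ T : ℝ} {N M : ℕ}

/-- **The bypass as the far PAIRING of a κ-defect** (`M ≥ 1`): for every left-block observable `F` with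
`F∘π_N ∈ L²(μ_T)`, `−K₀₃ = (γ²/T²)·⟨g_0 − F∘π_N, p_{L−1}² − T⟩_{μ_T}` — the lifted left-block observable is
invisible to the far bath (landed `integral_sub_comp_restrictLeft_mul_kin_sub`). -/
theorem bypass_eq_defectPairing (hω : 0 < ω₂) (hl : 0 ≤ lam) (hβ : 0 ≤ β) (hM : 1 ≤ M) (hT : 0 < T) {κ : ℝ}
    (g : Fin 4 → PhaseSpace (N + M) → ℝ) (hg₀ : g 0 ∈ deviceResolventFields ω₂ lam β γ T N M 0 κ)
    {F : PhaseSpace N → ℝ}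
    (hF : MemLp (fun y : PhaseSpace (N + M) => F (y.1 ∘ Fin.castAdd M, y.2 ∘ Fin.castAdd M)) 2
      ((pinnedChain ω₂ lam β γ).gibbsMeasure (N + M) T)) :
    -(kuboMatrix ω₂ lam β γ T N M g 0 3) = γ ^ 2 / T ^ 2 *
      ∫ x, (g 0 x - F (x.1 ∘ Fin.castAdd M, x.2 ∘ Fin.castAdd M)) * (kin (N + M) (N + M - 1) x - T)
        ∂((pinnedChain ω₂ lam β γ).gibbsMeasure (N + M) T) := by
  have e : kuboMatrix ω₂ lam β γ T N M g 0 3 = -(γ ^ 2 / T ^ 2 *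
      ∫ x, g 0 x * (kin (N + M) (N + M - 1) x - T) ∂((pinnedChain ω₂ lam β γ).gibbsMeasure (N + M) T)) := by
    simp [kuboMatrix, termSite_three]
  rw [e, neg_neg, integral_sub_comp_restrictLeft_mul_kin_sub hω hl hβ γ hM hT hg₀.2.1 hF]

/-- **The κ-frame defect equation in PAIR FORM** (lambda form of helper V's `deviceResolvent_defect_pair`; `N, M ≥ 1`):
for a `C²` solution `g_0` of `κ g_0 − L_dev g_0 = p_0² − T` and a `C²` solution `g_N` of the bare `N`-chain's
`L_N^{T,T} g_N = −(p_0² − T)`, the defect `u = g_0 − g_N∘π_N` satisfies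
`X_H u + γ S_B u = −(V'(q_N − q_{N−1})·(∂_{p_{N−1}} g_N)∘π_N − κ g_0)`, `V'(r) = r + βr³`, `B = deviceWeight N M`. -/
theorem farDefect_pair (ω₂ lam β γ T κ : ℝ) (hN : 1 ≤ N) (hM : 1 ≤ M)
    {g₀ : PhaseSpace (N + M) → ℝ} {gN : PhaseSpace N → ℝ} (hg₀ : ContDiff ℝ 2 g₀) (hgN : ContDiff ℝ 2 gN)
    (hpde₀ : ∀ x, κ * g₀ x - deviceGenerator (pinnedChain ω₂ lam β γ) N M (fun _ => T) g₀ x = kin (N + M) 0 x - T)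
    (hpdeN : ∀ y, (pinnedChain ω₂ lam β γ).generator N T T gN y = -(kin N 0 y - T)) (x : PhaseSpace (N + M)) :
    1 * liouvilleOp (pinnedChain ω₂ lam β γ) (N + M)
          (fun y : PhaseSpace (N + M) => g₀ y - gN (y.1 ∘ Fin.castAdd M, y.2 ∘ Fin.castAdd M)) x +
        γ * bathOp (N + M) (deviceWeight N M) T
          (fun y : PhaseSpace (N + M) => g₀ y - gN (y.1 ∘ Fin.castAdd M, y.2 ∘ Fin.castAdd M)) x =
      -((((x.1 ⟨N, by omega⟩ - x.1 ⟨N - 1, by omega⟩) + β * (x.1 ⟨N, by omega⟩ - x.1 ⟨N - 1, by omega⟩) ^ 3) *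
          partialP ⟨N - 1, by omega⟩ gN (x.1 ∘ Fin.castAdd M, x.2 ∘ Fin.castAdd M)) - κ * g₀ x) := by
  -- adapted from `deviceResolvent_defect` (…StubTerminationLocalityAux5)
  have hcomp : ContDiff ℝ 2 (gN ∘ restrictLeft N M) :=
    Theorems.SuperadditiveResistance.TerminationLocality.contDiff_comp_restrictLeft hgN
  have h1 := Theorems.SuperadditiveResistance.TerminationLocality.deviceGenerator_sub
    (pinnedChain ω₂ lam β γ) N M T hg₀ hcomp x
  have h2 := Theorems.SuperadditiveResistance.TerminationLocality.deviceGenerator_comp_restrictLeft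
    ω₂ lam β γ T hN hM gN x
  have h3 := hpdeN (restrictLeft N M x)
  rw [Theorems.SuperadditiveResistance.TerminationLocality.kin_restrictLeft (show 0 < N by omega)] at h3
  have h4 := hpde₀ x
  have hdev : deviceGenerator (pinnedChain ω₂ lam β γ) N M (fun _ => T)
      (fun y => g₀ y - (gN ∘ restrictLeft N M) y) x =
      -((((x.1 ⟨N, by omega⟩ - x.1 ⟨N - 1, by omega⟩) + β * (x.1 ⟨N, by omega⟩ - x.1 ⟨N - 1, by omega⟩) ^ 3) *
          partialP ⟨N - 1, by omega⟩ gN (restrictLeft N M x)) - κ * g₀ x) := by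
    rw [h1, h2, h3]
    linarith
  rw [deviceGenerator_eq] at hdev
  have hγ' : (pinnedChain ω₂ lam β γ).γ = γ := rfl
  rw [hγ', ← one_mul (liouvilleOp _ _ _ _)] at hdev
  exact hdev

/-- **The κ-frame FAR Green pairing across the junction (fixed `N, M, κ`; exact).** For `κ`-resolvent fields `g_0`
(bath `0`) and `g_3` (bath `3`, site `L−1`) of the `(N, M)`-device and a plain forward field `g_N` of the bare
`N`-chain (`N, M ≥ 1`), the defect `u = g_0 − g_N∘π_N` has far pairing
`⟨u, p_{L−1}² − T⟩_{μ_T} = ⟨g_3∘R, V'(q_N − q_{N−1})·(∂_{p_{N−1}} g_N)∘π_N⟩_{μ_T} − κ·⟨g_3∘R, g_N∘π_N⟩_{μ_T}`: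
the landed cross Green identity `Kubo.cross` for the forward pair `(u, V'(r_J)(∂_{p_{N−1}}g_N)∘π_N − κ g_0)`
against the backward pair `(g_3∘R, (p_{L−1}² − T) − κ g_3∘R)`; the two `κ⟨g_0, g_3∘R⟩` terms cancel. -/
theorem farDefect_pairing_resolvent (hω : 0 < ω₂) (hl : 0 ≤ lam) (hβ : 0 ≤ β) (hγ : 0 < γ) (hN : 1 ≤ N)
    (hM : 1 ≤ M) (hT : 0 < T) (κ : ℝ) {g₀ g₃ : PhaseSpace (N + M) → ℝ}
    (hg₀ : g₀ ∈ deviceResolventFields ω₂ lam β γ T N M 0 κ)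
    (hg₃ : g₃ ∈ deviceResolventFields ω₂ lam β γ T N M (N + M - 1) κ)
    {gN : PhaseSpace N → ℝ} (hgN : gN ∈ plainForwardFields ω₂ lam β γ T N) :
    ∫ x, (g₀ x - gN (x.1 ∘ Fin.castAdd M, x.2 ∘ Fin.castAdd M)) * (kin (N + M) (N + M - 1) x - T)
        ∂((pinnedChain ω₂ lam β γ).gibbsMeasure (N + M) T) =
      (∫ x, g₃ (x.1, -x.2) *
          (((x.1 ⟨N, by omega⟩ - x.1 ⟨N - 1, by omega⟩) + β * (x.1 ⟨N, by omega⟩ - x.1 ⟨N - 1, by omega⟩) ^ 3) *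
            partialP ⟨N - 1, by omega⟩ gN (x.1 ∘ Fin.castAdd M, x.2 ∘ Fin.castAdd M))
          ∂((pinnedChain ω₂ lam β γ).gibbsMeasure (N + M) T)) -
        κ * ∫ x, g₃ (x.1, -x.2) * gN (x.1 ∘ Fin.castAdd M, x.2 ∘ Fin.castAdd M)
          ∂((pinnedChain ω₂ lam β γ).gibbsMeasure (N + M) T) := by
  -- adapted from `resolventDefect_pairing` (…StubTerminationLocalityAux5): the backward pair is now the far bath's
  obtain ⟨hg₀C, hg₀L, hpde₀⟩ := hg₀
  obtain ⟨hg₃C, hg₃L, hpde₃⟩ := hg₃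
  obtain ⟨hgC, hgL2, -, hgpde⟩ := hgN
  set P := pinnedChain ω₂ lam β γ with hP
  set μ := P.gibbsMeasure (N + M) T with hμ
  -- the players
  set u : PhaseSpace (N + M) → ℝ := fun y => g₀ y - gN (y.1 ∘ Fin.castAdd M, y.2 ∘ Fin.castAdd M) with hu
  set J : PhaseSpace (N + M) → ℝ := fun x =>
    (((x.1 ⟨N, by omega⟩ - x.1 ⟨N - 1, by omega⟩) + β * (x.1 ⟨N, by omega⟩ - x.1 ⟨N - 1, by omega⟩) ^ 3) *
      partialP ⟨N - 1, by omega⟩ gN (x.1 ∘ Fin.castAdd M, x.2 ∘ Fin.castAdd M)) with hJ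
  set k₃ : PhaseSpace (N + M) → ℝ := fun x => x.2 ⟨N + M - 1, by omega⟩ ^ 2 - T with hk₃
  set gNπ : PhaseSpace (N + M) → ℝ := fun x => gN (x.1 ∘ Fin.castAdd M, x.2 ∘ Fin.castAdd M) with hgNπ
  -- regularity
  have hgNπC : ContDiff ℝ 2 gNπ := contDiff_comp_restrictLeft hgC
  have hgNπL : MemLp gNπ 2 μ := memLp_comp_restrictLeft hω hl hβ γ hN hM hT hgL2
  have huC : ContDiff ℝ 2 u := hg₀C.sub hgNπC
  have huL : MemLp u 2 μ := hg₀L.sub hgNπL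
  have hrevC : ContDiff ℝ 2 (rev g₃) := contDiff_rev hg₃C
  have hrevL : MemLp (rev g₃) 2 μ := memLp_rev hω hl hβ (N + M) hT hg₃C.continuous hg₃L
  have hdgN : MemLp (partialP ⟨N - 1, by omega⟩ gN) 2 (P.gibbsMeasure N T) :=
    memLp_partialP_plainField hω hl hβ hγ hN hT hgC hgL2 hgpde
  have hJL : MemLp J 2 μ :=
    memLp_junctionForce_mul_comp_restrictLeft hω hl hβ γ hN hM hT
      (continuous_partialP (hgC.of_le (by norm_cast) : ContDiff ℝ 1 gN) one_ne_zero _) hdgN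
  have hk₃L : MemLp k₃ 2 μ := memLp_kinetic (γ := γ) hω hl hβ (N + M) hT ⟨N + M - 1, by omega⟩
  have hkfL : MemLp (fun x => J x - κ * g₀ x) 2 μ := hJL.sub (hg₀L.const_mul κ)
  have hkhL : MemLp (fun x => k₃ x - κ * rev g₃ x) 2 μ := hk₃L.sub (hrevL.const_mul κ)
  -- the two pairs
  have hpair_u : ∀ x, 1 * liouvilleOp P (N + M) u x + γ * bathOp (N + M) (deviceWeight N M) T u x =
      -(J x - κ * g₀ x) := fun x => farDefect_pair ω₂ lam β γ T κ hN hM hg₀C hgC hpde₀ hgpde x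
  have hpair₃ : ∀ x, 1 * liouvilleOp P (N + M) g₃ x + γ * bathOp (N + M) (deviceWeight N M) T g₃ x =
      -((x.2 ⟨N + M - 1, by omega⟩ ^ 2 - T) - κ * g₃ x) := by
    intro x
    have h := hpde₃ x
    rw [deviceGenerator_eq, kin_eq_sq (show N + M - 1 < N + M by omega)] at h
    have hγ' : P.γ = γ := rfl
    rw [hγ'] at h
    linarith
  have hpair_rev : ∀ x, -1 * liouvilleOp P (N + M) (rev g₃) x + γ * bathOp (N + M) (deviceWeight N M) T (rev g₃) x =
      -(k₃ x - κ * rev g₃ x) := by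
    intro x
    have h := rev_pair P (deviceWeight N M) T 1 γ
      (k := fun y => (y.2 ⟨N + M - 1, by omega⟩ ^ 2 - T) - κ * g₃ y) hpair₃ x
    rw [h, rev_apply, rev_apply]
    simp [hk₃]
  -- the cross Green identity (density form)
  have hcross := cross hω hl hβ (N + M) hT (deviceWeight N M) (deviceWeight_nonneg N M) 1 hγ
    huC hrevC huL hrevL hkfL hkhL hpair_u hpair_rev
  -- expand both sides
  set ρ := P.gibbsDensity (N + M) T with hρ
  have hI1 := integrable_mul_mul_gibbsDensity hω hl hβ γ (N + M) hT hrevL hJL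
  have hI2 := integrable_mul_mul_gibbsDensity hω hl hβ γ (N + M) hT hrevL hg₀L
  have hI3 := integrable_mul_mul_gibbsDensity hω hl hβ γ (N + M) hT huL hk₃L
  have hI4 := integrable_mul_mul_gibbsDensity hω hl hβ γ (N + M) hT huL hrevL
  have hI5 := integrable_mul_mul_gibbsDensity hω hl hβ γ (N + M) hT hgNπL hrevL
  have eL : ∫ x, rev g₃ x * (J x - κ * g₀ x) * ρ x =
      (∫ x, rev g₃ x * J x * ρ x) - κ * ∫ x, rev g₃ x * g₀ x * ρ x := by
    rw [← integral_const_mul, ← integral_sub hI1 (hI2.const_mul κ)]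
    exact integral_congr_ae (ae_of_all _ fun x => by ring)
  have eR : ∫ x, u x * (k₃ x - κ * rev g₃ x) * ρ x =
      (∫ x, u x * k₃ x * ρ x) - κ * ∫ x, u x * rev g₃ x * ρ x := by
    rw [← integral_const_mul, ← integral_sub hI3 (hI4.const_mul κ)]
    exact integral_congr_ae (ae_of_all _ fun x => by ring)
  have eU : ∫ x, u x * rev g₃ x * ρ x = (∫ x, rev g₃ x * g₀ x * ρ x) - ∫ x, gNπ x * rev g₃ x * ρ x := by
    rw [← integral_sub hI2 hI5]
    exact integral_congr_ae (ae_of_all _ fun x => by simp only [hu, hgNπ]; ring)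
  rw [eL, eR, eU] at hcross
  have key : ∫ x, u x * k₃ x * ρ x = (∫ x, rev g₃ x * J x * ρ x) - κ * ∫ x, gNπ x * rev g₃ x * ρ x := by
    linear_combination (-1 : ℝ) * hcross
  -- back to the Gibbs measure
  rw [P.integral_gibbsMeasure, P.integral_gibbsMeasure, P.integral_gibbsMeasure]
  have e1 : ∫ x, (g₀ x - gN (x.1 ∘ Fin.castAdd M, x.2 ∘ Fin.castAdd M)) * (kin (N + M) (N + M - 1) x - T) * ρ x =
      ∫ x, u x * k₃ x * ρ x :=
    integral_congr_ae (ae_of_all _ fun x => by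
      simp only [hu, hk₃]; rw [kin_eq_sq (show N + M - 1 < N + M by omega)])
  have e2 : ∫ x, g₃ (x.1, -x.2) *
      (((x.1 ⟨N, by omega⟩ - x.1 ⟨N - 1, by omega⟩) + β * (x.1 ⟨N, by omega⟩ - x.1 ⟨N - 1, by omega⟩) ^ 3) *
        partialP ⟨N - 1, by omega⟩ gN (x.1 ∘ Fin.castAdd M, x.2 ∘ Fin.castAdd M)) * ρ x =
      ∫ x, rev g₃ x * J x * ρ x := rfl
  have e3 : ∫ x, g₃ (x.1, -x.2) * gN (x.1 ∘ Fin.castAdd M, x.2 ∘ Fin.castAdd M) * ρ x =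
      ∫ x, gNπ x * rev g₃ x * ρ x :=
    integral_congr_ae (ae_of_all _ fun x => by simp only [hgNπ, rev_apply]; ring)
  rw [e1, e2, e3, key]
  ring

/-- **THE κ-FRAME FAR-TRANSMISSION IDENTITY (fixed `N, M, κ`; exact).** For the pinned chain (`ω₂ > 0`,
`lam, β ≥ 0`, `γ, T > 0`, `N, M ≥ 1`), any family `g` whose bath-`0` and bath-`3` members are `κ`-resolvent fields of
the device and ANY plain forward field `g_N` of the bare `N`-chain, the bypass is the single cross Green pairing

  `−K₀₃ = (γ²/T²)·(⟨g_3∘R, V'(q_N − q_{N−1})·(∂_{p_{N−1}} g_N)∘π_N⟩_{μ_T} − κ·⟨g_3∘R, g_N∘π_N⟩_{μ_T})`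

(`R` the momentum reversal, `V'(r) = r + βr³`): `⟨g_0, p_{L−1}²−T⟩ = ⟨u, p_{L−1}²−T⟩` (the lifted bare field is
invisible to the far bath) `=` the far Green pairing of the defect (`farDefect_pairing_resolvent`). So S2' is
EXACTLY an `N`-uniform bound on this pairing of the far bath's backward resolvent field with the junction forcing
of the bare field's momentum gradient at its γ-thermostatted end (plus the mass term, `O(√κ)` at fixed `N`). -/
theorem bypass_eq_farPairing (hω : 0 < ω₂) (hl : 0 ≤ lam) (hβ : 0 ≤ β) (hγ : 0 < γ) (hT : 0 < T)
    (hN : 1 ≤ N) (hM : 1 ≤ M) (κ : ℝ) (g : Fin 4 → PhaseSpace (N + M) → ℝ) (gN : PhaseSpace N → ℝ)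
    (hg₀ : g 0 ∈ deviceResolventFields ω₂ lam β γ T N M 0 κ)
    (hg₃ : g 3 ∈ deviceResolventFields ω₂ lam β γ T N M (N + M - 1) κ)
    (hgN : gN ∈ plainForwardFields ω₂ lam β γ T N) :
    -(kuboMatrix ω₂ lam β γ T N M g 0 3) = γ ^ 2 / T ^ 2 *
      ((∫ x, g 3 (x.1, -x.2) *
          (((x.1 ⟨N, by omega⟩ - x.1 ⟨N - 1, by omega⟩) + β * (x.1 ⟨N, by omega⟩ - x.1 ⟨N - 1, by omega⟩) ^ 3) *
            partialP ⟨N - 1, by omega⟩ gN (x.1 ∘ Fin.castAdd M, x.2 ∘ Fin.castAdd M))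
          ∂((pinnedChain ω₂ lam β γ).gibbsMeasure (N + M) T)) -
        κ * ∫ x, g 3 (x.1, -x.2) * gN (x.1 ∘ Fin.castAdd M, x.2 ∘ Fin.castAdd M)
          ∂((pinnedChain ω₂ lam β γ).gibbsMeasure (N + M) T)) := by
  rw [bypass_eq_defectPairing hω hl hβ hM hT g hg₀ (memLp_comp_restrictLeft hω hl hβ γ hN hM hT hgN.2.1),
    farDefect_pairing_resolvent hω hl hβ hγ hN hM hT κ hg₀ hg₃ hgN]

/-- Registered helper sub-goal `helper_bypassResolventIdentity` of stub `stub_bypassBound` (= `bypass_eq_farPairing`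
in stub form, for the skeleton's resolvent families): the κ-frame far-transmission identity. -/
theorem helper_bypassResolventIdentity : ∀ (ω₂ lam β γ T : ℝ), 0 < ω₂ → 0 ≤ lam → 0 ≤ β → 0 < γ → 0 < T → ∀ (N M : ℕ) (hN : 1 ≤ N) (hM : 1 ≤ M) (κ : ℝ) (g : Fin 4 → PhaseSpace (N + M) → ℝ) (gN : PhaseSpace N → ℝ), (∀ a : Fin 4, g a ∈ deviceResolventFields ω₂ lam β γ T N M (termSite N M a) κ) → gN ∈ plainForwardFields ω₂ lam β γ T N → -(kuboMatrix ω₂ lam β γ T N M g 0 3) = γ ^ 2 / T ^ 2 * ((∫ x, g 3 (x.1, -x.2) * (((x.1 ⟨N, by omega⟩ - x.1 ⟨N - 1, by omega⟩) + β * (x.1 ⟨N, by omega⟩ - x.1 ⟨N - 1, by omega⟩) ^ 3) * partialP ⟨N - 1, by omega⟩ gN (x.1 ∘ Fin.castAdd M, x.2 ∘ Fin.castAdd M)) ∂((pinnedChain ω₂ lam β γ).gibbsMeasure (N + M) T)) - κ * ∫ x, g 3 (x.1, -x.2) * gN (x.1 ∘ Fin.castAdd M, x.2 ∘ Fin.castAdd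 M) ∂((pinnedChain ω₂ lam β γ).gibbsMeasure (N + M) T)) :=
  fun _ _ _ _ _ hω hl hβ hγ hT _ _ hN hM κ g gN hg hgN =>
    bypass_eq_farPairing hω hl hβ hγ hT hN hM κ g gN (hg 0) (hg 3) hgN

end Defect

/-! ## §2 The reduction of S2' to the far-pairing bound and its converse -/

section Reduction

/-- **REDUCTION OF S2' TO THE FAR-PAIRING BOUND (registered helper sub-goal `helper_bypassBoundOfFarPairingBound`).**
If the far pairing is bounded `N`-UNIFORMLY along the line's κ-frame — `∀ N M ≥ 2 ∃ κ₃ > 0 ∀ κ ∈ (0, κ₃]`, for every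
family of `κ`-resolvent fields of the four terminals and every plain forward field `g_N` of the bare `N`-chain,
`(γ²/T²)(⟨g_3∘R, V'(r_J)(∂_{p_{N−1}} g_N)∘π_N⟩ − κ⟨g_3∘R, g_N∘π_N⟩) ≤ C₃ K₀₀ K₃₃` (the named bet
`FarTransmissionRemainderBoundκ` with constant `C₃`) — then the conclusion of `stub_bypassBound` holds with the same
`C₃` and the same thresholds: by `bypass_eq_farPairing` and the landed existence of `g_N` (`stub_plainForwardField`). -/
theorem helper_bypassBoundOfFarPairingBound : ∀ (ω₂ lam β γ T : ℝ), 0 < ω₂ → 0 < lam → 0 < β → 0 < γ → 0 < T → ∀ (C₃ : ℝ), (∀ (N M : ℕ) (hN : 2 ≤ N) (hM : 2 ≤ M), ∃ κ₃ : ℝ, 0 < κ₃ ∧ ∀ κ : ℝ, 0 < κ → κ ≤ κ₃ → ∀ (g : Fin 4 → PhaseSpace (N + M) → ℝ) (gN : PhaseSpace N → ℝ), (∀ a : Fin 4, g a ∈ deviceResolventFields ω₂ lam β γ T N M (termSite N M a) κ) → gN ∈ plainForwardFields ω₂ lam β γ T N → γ ^ 2 / T ^ 2 * ((∫ x, g 3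 (x.1, -x.2) * (((x.1 ⟨N, by omega⟩ - x.1 ⟨N - 1, by omega⟩) + β * (x.1 ⟨N, by omega⟩ - x.1 ⟨N - 1, by omega⟩) ^ 3) * partialP ⟨N - 1, by omega⟩ gN (x.1 ∘ Fin.castAdd M, x.2 ∘ Fin.castAdd M)) ∂((pinnedChain ω₂ lam β γ).gibbsMeasure (N + M) T)) - κ * ∫ x, g 3 (x.1, -x.2) * gN (x.1 ∘ Fin.castAdd M, x.2 ∘ Fin.castAdd M) ∂((pinnedChain ω₂ lam β γ).gibbsMeasure (N + M) T)) ≤ C₃ * kuboMatrix ω₂ lam β γ T N M g 0 0 * kuboMatrix ω₂ lam β γ T N M g 3 3) → ∀ N M : ℕ, 2 ≤ N → 2 ≤ M → ∃ κ₃ : ℝ, 0 < κ₃ ∧ ∀ κ : ℝ, 0 < κ → κ ≤ κ₃ → ∀ g : Fin 4 → PhaseSpace (N + M) → ℝ, (∀ a : Fin 4, g a ∈ deviceResolventFields ω₂ lam β γ T N M (termSite N M a) κ) → -(kuboMatrix ω₂ lam β γ T N M g 0 3) ≤ C₃ * kuboMatrix ω₂ lam β γ T N M g 0 0 * kuboMatrix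 ω₂ lam β γ T N M g 3 3 := by
  intro ω₂ lam β γ T hω hlam hβ hγ hT C₃ hRB N M hN hM
  obtain ⟨κ₃, hκ₃, h⟩ := hRB N M hN hM
  refine ⟨κ₃, hκ₃, fun κ hκ hκle g hg => ?_⟩
  obtain ⟨gN, hgN⟩ := stub_plainForwardField ω₂ lam β γ T hω hlam hβ hγ hT N hN
  rw [bypass_eq_farPairing hω hlam.le hβ.le hγ hT (by omega) (by omega) κ g gN (hg 0) (hg 3) hgN]
  exact h κ hκ hκle g gN hg hgN

/-- **The converse**: the conclusion of `stub_bypassBound` at `(N, M, κ, g)` gives the far-pairing bound for EVERY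
plain forward field `g_N` (the identity read backwards; the pairing does not depend on the choice of `g_N`). So along
the line's resolvent families S2' and `FarTransmissionRemainderBoundκ` are EQUIVALENT, constant for constant. -/
theorem farPairingBound_of_bypassBound {ω₂ lam β γ T : ℝ} (hω : 0 < ω₂) (hl : 0 ≤ lam) (hβ : 0 ≤ β) (hγ : 0 < γ)
    (hT : 0 < T) {N M : ℕ} (hN : 1 ≤ N) (hM : 1 ≤ M) {κ C₃ : ℝ} (g : Fin 4 → PhaseSpace (N + M) → ℝ)
    (hg : ∀ a : Fin 4, g a ∈ deviceResolventFields ω₂ lam β γ T N M (termSite N M a) κ)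
    (hx : -(kuboMatrix ω₂ lam β γ T N M g 0 3) ≤
      C₃ * kuboMatrix ω₂ lam β γ T N M g 0 0 * kuboMatrix ω₂ lam β γ T N M g 3 3)
    (gN : PhaseSpace N → ℝ) (hgN : gN ∈ plainForwardFields ω₂ lam β γ T N) :
    γ ^ 2 / T ^ 2 * ((∫ x, g 3 (x.1, -x.2) *
        (((x.1 ⟨N, by omega⟩ - x.1 ⟨N - 1, by omega⟩) + β * (x.1 ⟨N, by omega⟩ - x.1 ⟨N - 1, by omega⟩) ^ 3) *
          partialP ⟨N - 1, by omega⟩ gN (x.1 ∘ Fin.castAdd M, x.2 ∘ Fin.castAdd M))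
        ∂((pinnedChain ω₂ lam β γ).gibbsMeasure (N + M) T)) -
      κ * ∫ x, g 3 (x.1, -x.2) * gN (x.1 ∘ Fin.castAdd M, x.2 ∘ Fin.castAdd M)
        ∂((pinnedChain ω₂ lam β γ).gibbsMeasure (N + M) T)) ≤
      C₃ * kuboMatrix ω₂ lam β γ T N M g 0 0 * kuboMatrix ω₂ lam β γ T N M g 3 3 := by
  rw [← bypass_eq_farPairing hω hl hβ hγ hT hN hM κ g gN (hg 0) (hg 3) hgN]
  exact hx

end Reduction

/-! ## §3 The remaining inequality as a set of admissible constants -/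

section Constants

/-- The set of ADMISSIBLE FAR-PAIRING CONSTANTS (an object, not a proposition): `C₃` such that the far-pairing bound
`(γ²/T²)(⟨g_3∘R, V'(r_J)(∂_{p_{N−1}} g_N)∘π_N⟩_{μ_T} − κ⟨g_3∘R, g_N∘π_N⟩_{μ_T}) ≤ C₃ K₀₀ K₃₃` holds `N`-uniformly and
eventually in `κ` (`∀ N M ≥ 2 ∃ κ₃ > 0 ∀ κ ∈ (0, κ₃]`, all resolvent families `g`, all plain forward fields `g_N` of
the bare `N`-chain) — the named bet `FarTransmissionRemainderBoundκ` holds with constant `C₃`. -/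
def bypassFarPairingConstants (ω₂ lam β γ T : ℝ) : Set ℝ :=
  {C₃ | ∀ (N M : ℕ) (hN : 2 ≤ N) (hM : 2 ≤ M), ∃ κ₃ : ℝ, 0 < κ₃ ∧ ∀ κ : ℝ, 0 < κ → κ ≤ κ₃ →
    ∀ (g : Fin 4 → PhaseSpace (N + M) → ℝ) (gN : PhaseSpace N → ℝ),
      (∀ a : Fin 4, g a ∈ deviceResolventFields ω₂ lam β γ T N M (termSite N M a) κ) →
      gN ∈ plainForwardFields ω₂ lam β γ T N →
      γ ^ 2 / T ^ 2 * ((∫ x, g 3 (x.1, -x.2) * (((x.1 ⟨N, by omega⟩ - x.1 ⟨N - 1, by omega⟩) + β * (x.1 ⟨N, by omega⟩ - x.1 ⟨N - 1, by omega⟩) ^ 3) * partialP ⟨N - 1, by omega⟩ gN (x.1 ∘ Fin.castAdd M, x.2 ∘ Fin.castAdd M)) ∂((pinnedChain ω₂ lam β γ).gibbsMeasure (N + M) T)) - κ * ∫ x, g 3 (x.1, -x.2) * gN (x.1 ∘ Fin.castAdd M, x.2 ∘ Fin.castAdd M) ∂((pinnedChain ω₂ lam β γ).gibbsMeasure (N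 + M) T)) ≤
        C₃ * kuboMatrix ω₂ lam β γ T N M g 0 0 * kuboMatrix ω₂ lam β γ T N M g 3 3}

/-- The set of ADMISSIBLE BYPASS CONSTANTS: `C₃` for which the conclusion of the registered stub `stub_bypassBound`
holds (`−K₀₃ ≤ C₃ K₀₀ K₃₃`, `N`-uniformly, eventually in `κ`, all resolvent families). -/
def bypassBoundConstants (ω₂ lam β γ T : ℝ) : Set ℝ :=
  {C₃ | ∀ N M : ℕ, 2 ≤ N → 2 ≤ M → ∃ κ₃ : ℝ, 0 < κ₃ ∧ ∀ κ : ℝ, 0 < κ → κ ≤ κ₃ →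
    ∀ g : Fin 4 → PhaseSpace (N + M) → ℝ,
      (∀ a : Fin 4, g a ∈ deviceResolventFields ω₂ lam β γ T N M (termSite N M a) κ) →
      -(kuboMatrix ω₂ lam β γ T N M g 0 3) ≤ C₃ * kuboMatrix ω₂ lam β γ T N M g 0 0 * kuboMatrix ω₂ lam β γ T N M g 3 3}

/-- **S2' IS the far-pairing bound**: for the crux's parameters (`ω₂, lam, β, γ, T > 0`) the admissible far-pairing
constants and the admissible bypass constants are THE SAME SET (`helper_bypassBoundOfFarPairingBound` and
`farPairingBound_of_bypassBound`). -/
theorem bypassFarPairingConstants_eq {ω₂ lam β γ T : ℝ} (hω : 0 < ω₂) (hlam : 0 < lam) (hβ : 0 < β) (hγ : 0 < γ)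
    (hT : 0 < T) : bypassFarPairingConstants ω₂ lam β γ T = bypassBoundConstants ω₂ lam β γ T := by
  ext C₃
  constructor
  · intro h
    exact helper_bypassBoundOfFarPairingBound ω₂ lam β γ T hω hlam hβ hγ hT C₃ h
  · intro h N M hN hM
    obtain ⟨κ₃, hκ₃, hb⟩ := h N M hN hM
    exact ⟨κ₃, hκ₃, fun κ hκ hκle g gN hg hgN =>
      farPairingBound_of_bypassBound hω hlam.le hβ.le hγ hT (by omega) (by omega) g hg (hb κ hκ hκle g hg) gN hgN⟩

/-- **The registered stub from ONE `N`-uniform inequality.** If the set of admissible far-pairing constants is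
nonempty (i.e. `FarTransmissionRemainderBoundκ` holds with some constant), the conclusion of `stub_bypassBound`
holds (with any such constant). -/
theorem stub_bypassBound_of_farPairingBound :
    ∀ ω₂ lam β γ T : ℝ, 0 < ω₂ → 0 < lam → 0 < β → 0 < γ → 0 < T →
      (bypassFarPairingConstants ω₂ lam β γ T).Nonempty →
      ∃ C₃ : ℝ, ∀ N M : ℕ, 2 ≤ N → 2 ≤ M → ∃ κ₃ : ℝ, 0 < κ₃ ∧ ∀ κ : ℝ, 0 < κ → κ ≤ κ₃ →
        ∀ g : Fin 4 → PhaseSpace (N + M) → ℝ,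
          (∀ a : Fin 4, g a ∈ deviceResolventFields ω₂ lam β γ T N M (termSite N M a) κ) →
          -(kuboMatrix ω₂ lam β γ T N M g 0 3) ≤
            C₃ * kuboMatrix ω₂ lam β γ T N M g 0 0 * kuboMatrix ω₂ lam β γ T N M g 3 3 := by
  intro ω₂ lam β γ T hω hlam hβ hγ hT hne
  obtain ⟨C₃, hC₃⟩ := hne
  exact ⟨C₃, helper_bypassBoundOfFarPairingBound ω₂ lam β γ T hω hlam hβ hγ hT C₃ hC₃⟩

/-- Conversely, every constant of the stub's conclusion is an admissible far-pairing constant. -/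
theorem mem_bypassFarPairingConstants_of_bypassBound {ω₂ lam β γ T : ℝ} (hω : 0 < ω₂) (hlam : 0 < lam) (hβ : 0 < β)
    (hγ : 0 < γ) (hT : 0 < T) {C₃ : ℝ} (h : C₃ ∈ bypassBoundConstants ω₂ lam β γ T) :
    C₃ ∈ bypassFarPairingConstants ω₂ lam β γ T := by
  rw [bypassFarPairingConstants_eq hω hlam hβ hγ hT]
  exact h

end Constants

end Summit.AtomisticToContinuum.FouriersLaw.Cruxes.SuperadditiveResistance.FloatingProbeBypassLaplacian

end
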